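import Summits.QuantumFields.BalabanUV.Beta.GAN24.CombBornBorderContactPairCells
import Summits.QuantumFields.BalabanUV.Beta.GAN24.CombBornBorderContactNest
import Summits.QuantumFields.BalabanUV.Beta.GAN24.BornBorderContactPairBound
import Summits.QuantumFields.BalabanUV.Beta.GAN24.CombLegEnvelope

/-!
# `BalabanUV.Beta.GAN24.CombBornBorderContactPairBound` — row G-an2-4 ∕ (CONV-C), TRANSFER-III, the (III′) S-slot (b): **THE BORN-V CONTACT PAIR `hPcV` OF road-P2 M.104 IS A THEOREM
# from `2 ≤ Lc` alone** (`d = 3`, pin, every `cVH`, every sym record with `tabs.V = symVhSAt ρ_t`): the (III′) twin of leaf-03 g56's (E) `BornBorderContactPairBound` — per lineage the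
# OWNER's `CombBornBorderContactNest.combContact_v_eq_of_top ∕ _of_succ` at BOTH towers (no `𝒯 − 1` defect), then the OWNER's cells `CombBornBorderContactPairCells.pair_cells_le_top ∕ _succ` = the OWNER's
# `CombBornBorderContactPairLineage` fed with the TREE letters: leaf-14 (N1), road-P2 CT-4a `RespStepCauchy.exists_respStep_cauchy` (both weakened to ONE rate `min κ₁ κ₂`), the
# OWNER's conjugated envelope `CombLegEnvelope.exists_legChain_psiLeg_envelope`, M.59 `combLegChain_sub_respStep` (twice), the OWNER's `CombContactGaugeStaircaseMergedPair` (the six gauge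
# letters, `A = (8Lc + F(1+8Lc(e^{κ}+1)))(1+Lc)`, `F = faceWtSum (ctrOff 4 Lc) Lc`), the K-slot `convCKWall_holds` through leaf-03's TABLE-FREE tents ∕ tent pairs
# (`BornBorderContactBound` §1, `BornBorderContactPairTent`) and `le_fold_rate` BY NAME (OWNER `b2b-balaban-gan24-p1` gen 55; `HCV-DESIGN-g55.md` §2)

NOT IN PRINT — OUR PROOF ATTEMPT ([folklore] assembly BY NAME; 0 `def`, 0 cited fact, 0 `def … : Prop`, 0 sorry; NO hypothesis beyond `2 ≤ Lc`, the pin, an in-block table root and the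
off-diagonal shape `hVff hVmm` of the record).
HONEST FRAMING (cell contract, verbatim): «discharging `BetaPertH` makes Bałaban's UV stability UNCONDITIONAL — a real constructive-QFT result; it is NOT the continuum limit
and NOT the Clay problem.»  HONEST DEPENDENCY (verbatim): «continuum YM on T⁴ ⇐ BetaPertH ∧ nine spine estimates (0/9 proved); BetaPertH ⇐ (D1) ∧ (D4) ∧ CAP+tail; G-an2-4
gates asym, D1 and NE2/3/4.»  WHAT THIS DISCHARGES AND WHAT NOT: the pair letter `hPcV` of M.104 ∕ leaf-01 (20) ∕ the OWNER's S54c; NOT (hS, hSall), NOT the END; NEVER «G-an2-4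
closed» as (CONV-C); NOT D1, NOT BetaPertH, NOT continuum, NOT Clay.  2026-08-28; no existing file touched.

## What is proved (`d = 3`, `2 ≤ Lc`)
**`exists_comb_hCgV_pair_three`** (the contact V pair letter in `LocStencil` currency: `C·((k−i)^1·Θ^k)`),
**`exists_comb_hPcV_three (hcE : cE = Lc^(3+1))`** = M.104's `hPcV` binder at the record `tabs`, `q = 1`.
-/

noncomputable section

open scoped BigOperators
open Literature.MathematicalPhysics.QuantumFieldTheory
open Literature.MathematicalPhysics.QuantumFieldTheory.LatticeForm (quo)
open Literature.MathematicalPhysics.QuantumFieldTheory.Balaban1983to89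
open Literature.MathematicalPhysics.QuantumFieldTheory.Balaban1983to89.Beta
open B4ContourShift (supNorm supNorm_nonneg)
open B12Sec2to5 (l1 l1_nonneg)
open ExpKernelCalculus (MKer Decays Zl Zl_nonneg)
open AffineAveraging (Form1 Site box toSite)
open AveragingHessianKernels (ell)
open Summit.QuantumFields.BalabanUV.Beta.SymAveragingHessianCounts (symVhSAt)
open Summit.QuantumFields.BalabanUV.Beta.SymmetrisedStepJets (SymTables)
open Summit.QuantumFields.BalabanUV.Beta.SymCorrectorFace (faceWtSum faceWtSum_nonneg)
open AveragingContoursRooted (ctr ctrOff ctrOff_mem_box)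
open Summit.QuantumFields.BalabanUV.Beta.GAN24.ContactLambdaCellBound (exp_env_mono_rate)
open OneStepResolventKernel (Fib LocStencil)
open BalabanCompositeJets (respStep)
open Summit.QuantumFields.BalabanUV.Beta.GAN24.CombesThomas (sfStep smStep KStepUnit UnitDecayK CauchyDecayK SupBound)
open Summit.QuantumFields.BalabanUV.Beta.GAN24.KSlotAssembly (convCKWall_holds)
open Summit.QuantumFields.BalabanUV.Beta.GAN24.Push3 (push₃)
open Summit.QuantumFields.BalabanUV.Beta.GAN24.AffineUnroll (transport)
open Summit.QuantumFields.BalabanUV.Beta.GAN24.SrecLinearPartEq (colM rowMM reslot legDecay_colM legDecay_rowMM)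
open Summit.QuantumFields.BalabanUV.Beta.GAN24.CombBornSector (combUnitStepMap)
open Summit.QuantumFields.BalabanUV.Beta.GAN24.UndressedResponseUnits (inv_cast_pow_pow)
open Summit.QuantumFields.BalabanUV.Beta.GAN24.RespStepDecay (exists_respStep_decay_and_grad)
open Summit.QuantumFields.BalabanUV.Beta.GAN24.RespStepCauchy (exists_respStep_cauchy)
open Summit.QuantumFields.BalabanUV.Beta.GAN24.CombLegEnvelope (exists_legChain_psiLeg_envelope)
open Summit.QuantumFields.BalabanUV.Beta.GAN24.CombBornBorderContactNest (combContact_v_eq_of_succ combContact_v_eq_of_top)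
open Summit.QuantumFields.BalabanUV.Beta.GAN24.BornBorderContactPairBound (le_fold_rate)
open Summit.QuantumFields.BalabanUV.Beta.GAN24.BornLambdaDriftSup (locStencil_zero_of_locStencil locStencil_zero_iff_supBound)
open Summit.QuantumFields.BalabanUV.Beta.GAN24.CombBornBorderContactPairCells (pair_cells_le_top pair_cells_le_succ)

namespace Summit.QuantumFields.BalabanUV.Beta.GAN24.CombBornBorderContactPairBound

section Three

variable {Lc : ℕ} [NeZero Lc] (tabs : SymTables 3 Lc) (hVff : ∀ κ u x y (α β : Fin (3 + 1)), tabs.V κ u x y (Sum.inl α) (Sum.inl β) = 0)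
  (hVmm : ∀ κ u x y (μ ν : Fin (3 + 1)), tabs.V κ u x y (Sum.inr μ) (Sum.inr ν) = 0)
include hVff hVmm

set_option maxHeartbeats 800000 in
/-- NOT IN PRINT; OUR PROOF ATTEMPT of the V twin of leaf-01 g61's BORN-CONTACT-DIFF-PLAN v0, ASSEMBLED («(V-C)-DIFF» END).  **THE CONTACT V PAIR LETTER OF THE BORN-V RATE HALF** (`d = 3`,
`2 ≤ Lc`): at the pin `|cE| ≤ Lc^4` and for every scale `cVH` there are `C ≥ 0`, `0 ≤ Θ < 1`, `δ > 0` such that for EVERY in-block root `rr ∈ box (3+1) Lc` and EVERY `i < k`,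
`LocStencil ((D_{i+1,k+1} − U_{i+1,k+1}) − (D_{i,k} − U_{i,k})) (C·(((k−i:ℕ):ℝ)^1·Θ^k)) δ` — the lower member is the display of `BornBorderContactBound.exists_hCgV_three` VERBATIM, the upper member
the same under `i ↦ i+1` with the transport length `k−1−i` and the weight exponent `k−i` unchanged (= leaf-04 g57's pair display).  Per lineage `k = i+n+1`: (C1) for both members, then (C)
`abs_weight_mul_contact_v_pair_le_three` with the tree letters: (N1) `exists_respStep_decay_and_grad`, CT-4a `exists_respStep_cauchy` (undressed-leg pair `c_Δ = c·θ₁^{i+n}`; the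
differenced staircase by Pack §A `abs_gaugePieceSucc_le`), `exists_legChain_envelope` at births `i`, `i+1`, the K-slot's `convCKWall_holds` (tents via (D⁻) §1, tent pairs via §1:
`T_Δ = cK·θ₂^{i+n}·e^{δ}`), and `le_fold_rate` (`Θ = max (max θ₁ θ₂) Lc⁻¹`; rate `min (min δ κ₁) κ₂ ∕ 96`). -/
theorem exists_comb_hCgV_pair_three (hLc : 2 ≤ Lc) {rt : Fin (3 + 1) → ℕ} (hrt : rt ∈ box (3 + 1) Lc) (hV : tabs.V = symVhSAt (toSite rt) 3 Lc rfl)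
    (cE cVH : ℝ) (hcE : |cE| ≤ (Lc : ℝ) ^ 4) :
    ∃ C Θ δ : ℝ, 0 ≤ C ∧ 0 ≤ Θ ∧ Θ < 1 ∧ 0 < δ ∧ ∀ k i : ℕ, i < k →
      LocStencil
        ((transport (combUnitStepMap Lc cE) (i + 1 + 1) (k - 1 - i)
            (combUnitStepMap Lc cE (i + 1) (fun κ u => cVH • tabs.V κ u))
          - fun κ' u' => (cE * (Lc : ℝ) ^ (2 * (3 + 1))) ^ (k - i) •
            push₃ (respStep (d := 3) (Lc ^ (i + 1 + 1)) (Lc ^ (k + 1))) (respStep (d := 3) (Lc ^ (i + 1 + 1)) (Lc ^ (k + 1)))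
              (respStep (d := 3) (Lc ^ (i + 1 + 1)) (Lc ^ (k + 1)))
              (fun κ u => -(push₃ (-respStep (d := 3) (Lc ^ (i + 1)) (Lc ^ (i + 1 + 1))) (colM (KStepUnit (d := 3) Lc (i + 1)) Lc)
                    (respStep (d := 3) (Lc ^ (i + 1)) (Lc ^ (i + 1 + 1))) (reslot Sum.inl Sum.inr fun κ u => cVH • tabs.V κ u) κ u
                + push₃ (rowMM (KStepUnit (d := 3) Lc (i + 1)) Lc) (respStep (d := 3) (Lc ^ (i + 1)) (Lc ^ (i + 1 + 1)))
                    (respStep (d := 3) (Lc ^ (i + 1)) (Lc ^ (i + 1 + 1))) (reslot Sum.inr Sum.inl fun κ u => cVH • tabs.V κ u) κ u)) κ' u')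
        - (transport (combUnitStepMap Lc cE) (i + 1) (k - 1 - i)
            (combUnitStepMap Lc cE i (fun κ u => cVH • tabs.V κ u))
          - fun κ' u' => (cE * (Lc : ℝ) ^ (2 * (3 + 1))) ^ (k - i) •
            push₃ (respStep (d := 3) (Lc ^ (i + 1)) (Lc ^ k)) (respStep (d := 3) (Lc ^ (i + 1)) (Lc ^ k)) (respStep (d := 3) (Lc ^ (i + 1)) (Lc ^ k))
              (fun κ u => -(push₃ (-respStep (d := 3) (Lc ^ i) (Lc ^ (i + 1))) (colM (KStepUnit (d := 3) Lc i) Lc)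
                    (respStep (d := 3) (Lc ^ i) (Lc ^ (i + 1))) (reslot Sum.inl Sum.inr fun κ u => cVH • tabs.V κ u) κ u
                + push₃ (rowMM (KStepUnit (d := 3) Lc i) Lc) (respStep (d := 3) (Lc ^ i) (Lc ^ (i + 1)))
                    (respStep (d := 3) (Lc ^ i) (Lc ^ (i + 1))) (reslot Sum.inr Sum.inl fun κ u => cVH • tabs.V κ u) κ u)) κ' u'))
        (C * (((k - i : ℕ) : ℝ) ^ 1 * Θ ^ k)) δ := by
  have hLc1 : 1 ≤ Lc := le_trans (by norm_num) hLc
  have hL : (0 : ℝ) < (Lc : ℝ) := Nat.cast_pos.2 (Nat.pos_of_ne_zero (NeZero.ne Lc))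
  -- the tree letters, constants outside every ∀
  obtain ⟨κ₁, C₁, -, hκ₁, hC₁, -, hN1raw, -⟩ := exists_respStep_decay_and_grad (Lc := Lc)
  have hN1 : ∀ (m k : ℕ) (μ : Fin (3 + 1)) (z : Site (3 + 1)) (l'' : Fin (3 + 1)) (w' : Site (3 + 1)),
      |respStep (d := 3) (Lc ^ m) (Lc ^ (m + k + 1)) μ z l'' w'| ≤
        C₁ * ((Lc : ℝ) ^ (5 * (k + 1)))⁻¹ * Real.exp (-(κ₁ * supNorm (quo (Lc ^ (k + 1)) w' - z))) := by
    intro m k μ z l'' w'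
    have h := hN1raw m k μ z l'' w'
    rwa [inv_cast_pow_pow] at h
  obtain ⟨c, θ₁, κ₂, hc, hθ₁, hθ₁1, hκ₂, hCau⟩ := exists_respStep_cauchy (Lc := Lc) hLc
  obtain ⟨κE, KE, hκE, -, hEnv0⟩ := exists_legChain_psiLeg_envelope (Lc := Lc) hLc
  have hr : ctrOff (3 + 1) Lc ∈ box (3 + 1) Lc := ctrOff_mem_box hLc1
  have hEnv := hEnv0 _ hr _ hr
  have hκm : 0 < min κ₁ κ₂ := lt_min hκ₁ hκ₂
  have hN1m : ∀ (m k : ℕ) (μ : Fin (3 + 1)) (z : Site (3 + 1)) (l'' : Fin (3 + 1)) (w' : Site (3 + 1)),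
      |respStep (d := 3) (Lc ^ m) (Lc ^ (m + k + 1)) μ z l'' w'| ≤
        C₁ * ((Lc : ℝ) ^ (5 * (k + 1)))⁻¹ * Real.exp (-(min κ₁ κ₂ * supNorm (quo (Lc ^ (k + 1)) w' - z))) := fun m k μ z l'' w' =>
    (hN1 m k μ z l'' w').trans (mul_le_mul_of_nonneg_left (exp_env_mono_rate (min_le_left _ _) (supNorm_nonneg _)) (by positivity))
  have hCaum : ∀ (s k : ℕ) (μ : Fin (3 + 1)) (z : Site (3 + 1)) (l : Fin (3 + 1)) (w : Site (3 + 1)),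
      |respStep (d := 3) (Lc ^ (s + 1)) (Lc ^ (s + k + 2)) μ z l w - respStep (d := 3) (Lc ^ s) (Lc ^ (s + k + 1)) μ z l w|
        ≤ c * θ₁ ^ (s + k) * ((((Lc ^ (k + 1) : ℕ) : ℝ)) ^ (3 + 2))⁻¹ * Real.exp (-(min κ₁ κ₂ * supNorm (quo (Lc ^ (k + 1)) w - z))) := fun s k μ z l w =>
    (hCau s k μ z l w).trans (mul_le_mul_of_nonneg_left (exp_env_mono_rate (min_le_right _ _) (supNorm_nonneg _)) (by positivity))
  obtain ⟨Cst, δ, cK, θ₂, hδ, hθ₂, hθ₂1, hK, hKall⟩ := convCKWall_holds (Lc := Lc) hLc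
  have hCst : 0 ≤ Cst := (hK 0).nonneg (Sum.inl 0)
  have hF0 : 0 ≤ faceWtSum (ctrOff (3 + 1) Lc) Lc := faceWtSum_nonneg _ _
  have hcK : 0 ≤ cK := by simpa only [pow_zero, mul_one] using (hKall 0 0).nonneg (Sum.inl 0)
  have hTb : 0 ≤ Cst * Real.exp δ := by positivity
  set κ : ℝ := min (min δ (min κ₁ κ₂)) (min κ₁ κ₂) with hκdef
  have hκ : 0 < κ := lt_min (lt_min hδ hκm) hκm
  set Θ : ℝ := max (max θ₁ θ₂) (Lc : ℝ)⁻¹ with hΘdef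
  have hΘ0 : 0 ≤ Θ := hθ₁.trans ((le_max_left _ _).trans (le_max_left _ _))
  have hΘ1 : Θ < 1 := by
    refine max_lt (max_lt hθ₁1 hθ₂1) ?_
    have h2 : (2 : ℝ) ≤ Lc := by exact_mod_cast hLc
    rw [inv_lt_one_iff₀]; right; linarith
  have hZ : 0 ≤ Zl (3 + 1) (κ / (4 * ((3 : ℝ) + 1))) := Zl_nonneg (by positivity)
  refine ⟨|cVH| * (2 * ((Lc : ℝ) ^ 3 * (((((3 + 1).factorial : ℕ) : ℝ) * (Lc : ℝ) ^ (3 + 1))⁻¹ * (((3 : ℝ) + 1) * (Real.exp (2 * ((3 : ℝ) + 1) * κ) ^ 2 *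
              (((2 * Lc : ℕ) : ℝ) ^ (3 + 1) * (((3 + 1 : ℕ) : ℝ) * ((((3 + 1).factorial : ℕ) : ℝ) * ((Lc : ℝ) ^ (3 + 1) * (ell (3 + 1) Lc : ℝ)))))))
            * (4 * ((8 * (Lc : ℝ) + faceWtSum (ctrOff (3 + 1) Lc) Lc * (1 + 8 * (Lc : ℝ) * (Real.exp (min κ₁ κ₂) + 1))) * (1 + (Lc : ℝ))) + 4 * ((8 * (Lc : ℝ) + faceWtSum (ctrOff (3 + 1) Lc) Lc * (1 + 8 * (Lc : ℝ) * (Real.exp (min κ₁ κ₂) + 1))) * (1 + (Lc : ℝ))) ^ 2 + 4 * ((8 * (Lc : ℝ) + faceWtSum (ctrOff (3 + 1) Lc) Lc * (1 + 8 * (Lc : ℝ) * (Real.exp (min κ₁ κ₂) + 1))) * (1 + (Lc : ℝ))) * Lc + 8 * ((8 * (Lc : ℝ) + faceWtSum (ctrOff (3 + 1) Lc) Lc * (1 + 8 * (Lc : ℝ) * (Real.exp (min κ₁ κ₂) + 1))) * (1 + (Lc : ℝ))) ^ 2 * Lc) * Zl (3 + 1) (κ / (4 * ((3 : ℝ) +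 1))))))
          * (2 * (Cst * Real.exp δ) * C₁ * c + (cK * Real.exp δ) * C₁ ^ 2),
    Θ, κ / 12 / 2 / ((3 : ℝ) + 1), by positivity, hΘ0, hΘ1, by positivity, ?_⟩
  intro k i hik
  obtain ⟨n, rfl⟩ : ∃ n, k = i + n + 1 := ⟨k - i - 1, by omega⟩
  intro κ' u'
  simp only [Pi.sub_apply]
  cases n with
  | zero =>
    have hup := combContact_v_eq_of_top tabs hVff hVmm cE cVH (i := i + 1) (k := i + 0 + 1 + 1) (by omega) κ' u'
    rw [show i + 0 + 1 + 1 - 1 - (i + 1) = i + 0 + 1 - 1 - i by omega, show i + 0 + 1 + 1 - (i + 1) = i + 0 + 1 - i by omega] at hup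
    rw [hup, combContact_v_eq_of_top tabs hVff hVmm cE cVH (i := i) (k := i + 0 + 1) rfl κ' u', hV]
    intro x z a b
    simp only [Pi.neg_apply, Pi.smul_apply, Pi.add_apply, Pi.sub_apply, smul_eq_mul]
    rw [neg_sub_neg, abs_sub_comm, ← mul_sub]
    have H := pair_cells_le_top (cVH := cVH) hLc hrt hcE hN1m hκm hC₁ hCaum hc hθ₁ hEnv hκE hK hKall hδ hcK hθ₂ i κ' u' x z a b
    refine le_fold_rate (i := i) (n := 0) (θ₁ := θ₁) (θ₂ := θ₂) (L := (Lc : ℝ)⁻¹) (by positivity) (by positivity) (by positivity) hθ₁ hθ₂ (inv_pos.2 hL).le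
      ((le_max_left _ _).trans (le_max_left _ _)) ((le_max_right _ _).trans (le_max_left _ _)) (le_max_right _ _)
      (inv_le_one_of_one_le₀ (by exact_mod_cast hLc1)) (Real.exp_pos _).le (H.trans (le_of_eq ?_))
    ring
  | succ m =>
    have hup := combContact_v_eq_of_succ tabs hVff hVmm cE cVH hLc (i := i + 1) (m := m) (k := i + (m + 1) + 1 + 1) (by omega) κ' u'
    rw [show i + (m + 1) + 1 + 1 - 1 - (i + 1) = i + (m + 1) + 1 - 1 - i by omega,
      show i + (m + 1) + 1 + 1 - (i + 1) = i + (m + 1) + 1 - i by omega] at hup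
    rw [hup, combContact_v_eq_of_succ tabs hVff hVmm cE cVH hLc (i := i) (m := m) (k := i + (m + 1) + 1) rfl κ' u', hV]
    intro x z a b
    simp only [Pi.neg_apply, Pi.smul_apply, Pi.add_apply, Pi.sub_apply, smul_eq_mul]
    rw [neg_sub_neg, abs_sub_comm, ← mul_sub]
    have H := pair_cells_le_succ (cVH := cVH) hLc hrt hcE hN1m hκm hC₁ hCaum hc hθ₁ hEnv hκE hK hKall hδ hcK hθ₂ i m κ' u' x z a b
    refine le_fold_rate (i := i) (n := m + 1) (θ₁ := θ₁) (θ₂ := θ₂) (L := (Lc : ℝ)⁻¹) (by positivity) (by positivity) (by positivity) hθ₁ hθ₂ (inv_pos.2 hL).le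
      ((le_max_left _ _).trans (le_max_left _ _)) ((le_max_right _ _).trans (le_max_left _ _)) (le_max_right _ _)
      (inv_le_one_of_one_le₀ (by exact_mod_cast hLc1)) (Real.exp_pos _).le (H.trans (le_of_eq ?_))
    ring


/-! ## §3 Docking: M.104's `hPcV` binder (sup currency, births `≥ 1`, `q = 1`) -/

/-- NOT IN PRINT; OUR BOOKKEEPING ([folklore]; `d = 3`, `2 ≤ Lc`, pin `cE = Lc^(3+1)`).  **road-P2 M.104's `hPcV` BINDER AT THE RECORD `tabs`, `q = 1`**: §2 with the decay forgotten
(`locStencil_zero_of_locStencil`, `locStencil_zero_iff_supBound`) and the pin bridged by one `rw`. -/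
theorem exists_comb_hPcV_three (hLc : 2 ≤ Lc) {rt : Fin (3 + 1) → ℕ} (hrt : rt ∈ box (3 + 1) Lc) (hV : tabs.V = symVhSAt (toSite rt) 3 Lc rfl)
    {cE : ℝ} (hcE : cE = (Lc : ℝ) ^ (3 + 1)) (cVH : ℝ) :
    ∃ CPc Θc : ℝ, 0 ≤ CPc ∧ 0 ≤ Θc ∧ Θc < 1 ∧ ∀ k i : ℕ, 1 ≤ i → i < k → ∀ κ u,
      SupBound
        (((transport (combUnitStepMap Lc cE) (i + 1 + 1) (k - 1 - i)
            (combUnitStepMap Lc cE (i + 1) (fun κ u => cVH • tabs.V κ u))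
          - fun κ' u' => (cE * (Lc : ℝ) ^ (2 * (3 + 1))) ^ (k - i) •
            push₃ (respStep (d := 3) (Lc ^ (i + 1 + 1)) (Lc ^ (k + 1))) (respStep (d := 3) (Lc ^ (i + 1 + 1)) (Lc ^ (k + 1)))
              (respStep (d := 3) (Lc ^ (i + 1 + 1)) (Lc ^ (k + 1)))
              (fun κ u => -(push₃ (-respStep (d := 3) (Lc ^ (i + 1)) (Lc ^ (i + 1 + 1))) (colM (KStepUnit (d := 3) Lc (i + 1)) Lc)
                    (respStep (d := 3) (Lc ^ (i + 1)) (Lc ^ (i + 1 + 1))) (reslot Sum.inl Sum.inr fun κ u => cVH • tabs.V κ u) κ u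
                + push₃ (rowMM (KStepUnit (d := 3) Lc (i + 1)) Lc) (respStep (d := 3) (Lc ^ (i + 1)) (Lc ^ (i + 1 + 1)))
                    (respStep (d := 3) (Lc ^ (i + 1)) (Lc ^ (i + 1 + 1))) (reslot Sum.inr Sum.inl fun κ u => cVH • tabs.V κ u) κ u)) κ' u')
        - (transport (combUnitStepMap Lc cE) (i + 1) (k - 1 - i)
            (combUnitStepMap Lc cE i (fun κ u => cVH • tabs.V κ u))
          - fun κ' u' => (cE * (Lc : ℝ) ^ (2 * (3 + 1))) ^ (k - i) •
            push₃ (respStep (d := 3) (Lc ^ (i + 1)) (Lc ^ k)) (respStep (d := 3) (Lc ^ (i + 1)) (Lc ^ k)) (respStep (d := 3) (Lc ^ (i + 1)) (Lc ^ k))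
              (fun κ u => -(push₃ (-respStep (d := 3) (Lc ^ i) (Lc ^ (i + 1))) (colM (KStepUnit (d := 3) Lc i) Lc)
                    (respStep (d := 3) (Lc ^ i) (Lc ^ (i + 1))) (reslot Sum.inl Sum.inr fun κ u => cVH • tabs.V κ u) κ u
                + push₃ (rowMM (KStepUnit (d := 3) Lc i) Lc) (respStep (d := 3) (Lc ^ i) (Lc ^ (i + 1)))
                    (respStep (d := 3) (Lc ^ i) (Lc ^ (i + 1))) (reslot Sum.inr Sum.inl fun κ u => cVH • tabs.V κ u) κ u)) κ' u')) κ u)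
        (CPc * ((((k - i : ℕ) : ℝ)) ^ 1 * Θc ^ k)) := by
  have habs : |cE| ≤ (Lc : ℝ) ^ 4 := by rw [hcE, abs_of_nonneg (by positivity)]
  obtain ⟨C, Θ, δ, hC, hΘ0, hΘ1, hδ, h⟩ := exists_comb_hCgV_pair_three tabs hVff hVmm hLc hrt hV cE cVH habs
  refine ⟨C, Θ, hC, hΘ0, hΘ1, fun k i _ hik => ?_⟩
  exact locStencil_zero_iff_supBound.1 (locStencil_zero_of_locStencil (h k i hik) hδ.le)

end Three

end Summit.QuantumFields.BalabanUV.Beta.GAN24.CombBornBorderContactPairBound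

end
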